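import Summits.QuantumFields.YangMills.Theorems.BalabanLadderIRColdDoublingRecursionSC
import HarnessLib

/-!
# Aspect-ratio bootstrap: the squaring constant sharpened to `2²⁰` (engine-facing packaging)

Line `aspect-bootstrap` on crux `BalabanLadder.IR` (stmt-QuantumFields-19354).  The landed bootstrap `defectSquaring`
(`Theorems/BalabanLadderIRDefectSquaring.lean`) packages the universal constant as `squaringConst = 2·432²·e^{432}`
(`≈ e^{447}`), which only comes from the crude last step `e^{432δ} ≤ e^{432}` (`δ ≤ 1`).  The proof's own δ-dependent
inequality is `δ(L') ≤ 2 (432 δ(L) e^{432 δ(L)})²` (`defectSquaring_exp`, unconditional); splitting at `δ(L) = 2⁻¹⁰` gives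
the constant **`2²⁰`** (`defectSquaring_two_pow`; note of seat ym-ir-idea-5 g4, 2026-08-28T01:56Z, «take it or leave it»),
hence for the Wilson model `coldDefect r.ρ β L' ≤ 2²⁰ · (coldDefect r.ρ β L)²` for all `β ≥ 0`, `L ≥ 8`, `L' ∈ [2L, 4L]`
(`coldDefect_sq_le_two_pow`) — so the doubling-bridge seam's basin threshold `1/(16C)` may be taken as `2⁻²⁴`.

HONEST FRAMING.  Nothing here proves the Yang–Mills mass gap (Clay), a lattice gap, or `BalabanLadder.IR`; R4 closes only
the conditional finite-𝕋⁴ rung `BalabanLadder.UV`.  Logically nothing downstream depends on the value of the constant (`C` is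
existential in `ColdDoublingRecursionSC`, proved as `coldDoublingRecursionSC_holds`); this file only makes the number honest.
-/

noncomputable section

open MeasureTheory
open Literature.MathematicalPhysics.QuantumFieldTheory Literature.MathematicalPhysics.QuantumLattice
open Summit.QuantumFields.YangMills.Cruxes.IR.ColdPurityBridge (coldDefect)

namespace Summit.QuantumFields.YangMills.Cruxes.IR.AspectBootstrap

section Family

variable {Z : ℕ → ℕ → ℕ → ℕ → ℝ}

/-- **The δ-dependent squaring inequality** (unconditional form of the last step of `defectSquaring`):
`boxDefect Z L' ≤ 2 (432 δ e^{432 δ})²`, `δ = boxDefect Z L`, for `L ≥ 8`, `L' ∈ [2L, 4L]`. -/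
theorem defectSquaring_exp (hS : IsAxisSymmetric Z) (hT : IsTracePositive Z) (hV : HasVolumeBounds Z)
    (L : ℕ) (hL : 8 ≤ L) (L' : ℕ) (h₁ : 2 * L ≤ L') (h₂ : L' ≤ 4 * L) :
    boxDefect Z L' ≤ 2 * (432 * boxDefect Z L * Real.exp (432 * boxDefect Z L)) ^ 2 := by
  obtain ⟨k, hk⟩ : ∃ k, L / 4 = k + 2 := ⟨L / 4 - 2, by omega⟩
  obtain ⟨k', hk'⟩ : ∃ k', L' / 4 = k' + 2 := ⟨L' / 4 - 2, by omega⟩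
  have hkk' : 2 * k + 2 ≤ k' := by omega
  have hLpos : 0 < L := by omega
  have hLL' : L ≤ L' := by omega
  have hL2 : 2 ≤ L := by omega
  have hL'2 : 2 ≤ L' := by omega
  have hz : HasSpectralDatum (Z L L L) := hT L L L hL2 hL2 hL2
  have hz' : HasSpectralDatum (Z L' L' L') := hT L' L' L' hL'2 hL'2 hL'2
  simp only [boxDefect, hk, hk']
  obtain ⟨hδ0, -, -, hδx⟩ := defect_facts hz k
  obtain ⟨-, hδ'1, hδ'x, -⟩ := defect_facts hz' k'
  set δ : ℝ := 1 - Z L L L (2 * (k + 2)) / Z L L L (k + 2) ^ 2 with hδdef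
  set δ' : ℝ := 1 - Z L' L' L' (2 * (k' + 2)) / Z L' L' L' (k' + 2) ^ 2 with hδ'def
  have hE1 : 1 ≤ Real.exp (432 * δ) := Real.one_le_exp (by positivity)
  by_cases hhalf : 1 / 2 ≤ δ
  · -- large defect: the right-hand side exceeds `2 · 216² ≥ 1 ≥ δ'`
    have h1 : 216 ≤ 432 * δ * Real.exp (432 * δ) := by nlinarith
    nlinarith
  push Not at hhalf
  have hx : exc (Z L L L) (k + 2) ≤ 2 * δ := hδx δ hhalf.le le_rfl
  have hy : Yfun (Z L L L) (k + 2) ≤ 2 * δ := (Yfun_le_exc hz k).trans hx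
  have hy0 : 0 ≤ Yfun (Z L L L) (k + 2) := Yfun_nonneg hz k
  have hLr : (0 : ℝ) < L := by exact_mod_cast hLpos
  have hq : (L' : ℝ) / L ≤ 4 := by
    rw [div_le_iff₀ hLr]
    have : ((L' : ℕ) : ℝ) ≤ ((4 * L : ℕ) : ℝ) := by exact_mod_cast h₂
    push_cast at this
    linarith
  have hq0 : 0 ≤ (L' : ℝ) / L := by positivity
  have e1 := extension_le hS hT hV hL2 hL2 hL hLL'
  have e2 := extension_le hS hT hV hL'2 hL2 hL hLL'
  have e3 := extension_le hS hT hV hL'2 hL'2 hL hLL'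
  rw [hk] at e1 e2 e3
  have s1 : Z L' L L = Z L L' L := funext fun τ => (hS L' L L τ).2.1
  have s2 : Z L' L' L = Z L L' L' := funext fun τ => (hS L' L' L τ).2.2
  rw [s1] at e1
  rw [s2] at e2
  have hY' : Yfun (Z L' L' L') (k + 2) ≤ 216 * Yfun (Z L L L) (k + 2) := by
    set q : ℝ := (L' : ℝ) / L
    calc Yfun (Z L' L' L') (k + 2) ≤ 3 / 2 * q * Yfun (Z L L' L') (k + 2) := e3
      _ ≤ 3 / 2 * q * (3 / 2 * q * Yfun (Z L L' L) (k + 2)) := mul_le_mul_of_nonneg_left e2 (by positivity)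
      _ ≤ 3 / 2 * q * (3 / 2 * q * (3 / 2 * q * Yfun (Z L L L) (k + 2))) :=
          mul_le_mul_of_nonneg_left (mul_le_mul_of_nonneg_left e1 (by positivity)) (by positivity)
      _ = 27 / 8 * q ^ 3 * Yfun (Z L L L) (k + 2) := by ring
      _ ≤ 27 / 8 * 4 ^ 3 * Yfun (Z L L L) (k + 2) := by gcongr
      _ = 216 * Yfun (Z L L L) (k + 2) := by norm_num
  have hx't : exc (Z L' L' L') (k + 2) ≤ Real.exp (432 * δ) - 1 := by
    rw [exc_eq_exp_Yfun hz' k]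
    have : Yfun (Z L' L' L') (k + 2) ≤ 432 * δ := by linarith
    linarith [Real.exp_le_exp.2 this]
  have hx't0 : 0 ≤ exc (Z L' L' L') (k + 2) := exc_nonneg hz' k
  have hx'T : exc (Z L' L' L') (k' + 2) ≤ exc (Z L' L' L') (k + 2) ^ 2 :=
    calc exc (Z L' L' L') (k' + 2) ≤ exc (Z L' L' L') (2 * k + 2 + 2) := exc_antitone hz' hkk'
      _ = exc (Z L' L' L') (2 * (k + 2)) := by ring_nf
      _ ≤ exc (Z L' L' L') (k + 2) ^ 2 := exc_two_mul_le_sq hz' k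
  have hu : Real.exp (432 * δ) - 1 ≤ 432 * δ * Real.exp (432 * δ) :=
    Literature.Analysis.ODE.exp_sub_one_le_mul_exp _
  have hu0 : 0 ≤ Real.exp (432 * δ) - 1 := by linarith
  calc δ' ≤ 2 * exc (Z L' L' L') (k' + 2) := hδ'x
    _ ≤ 2 * exc (Z L' L' L') (k + 2) ^ 2 := by linarith [hx'T]
    _ ≤ 2 * (Real.exp (432 * δ) - 1) ^ 2 := by gcongr
    _ ≤ 2 * (432 * δ * Real.exp (432 * δ)) ^ 2 := by gcongr

/-- **The squaring law with constant `2²⁰`**: `boxDefect Z L' ≤ 2²⁰ · (boxDefect Z L)²` for `L ≥ 8`, `L' ∈ [2L, 4L]`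
(split at `δ = 2⁻¹⁰`: above it the bound `δ' ≤ 1` suffices; below it `e^{864 δ} ≤ e < 2.72` in `defectSquaring_exp`). -/
theorem defectSquaring_two_pow (hS : IsAxisSymmetric Z) (hT : IsTracePositive Z) (hV : HasVolumeBounds Z)
    (L : ℕ) (hL : 8 ≤ L) (L' : ℕ) (h₁ : 2 * L ≤ L') (h₂ : L' ≤ 4 * L) :
    boxDefect Z L' ≤ 2 ^ 20 * boxDefect Z L ^ 2 := by
  have hmain := defectSquaring_exp hS hT hV L hL L' h₁ h₂
  have hL2 : 2 ≤ L := by omega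
  have hL'2 : 2 ≤ L' := by omega
  obtain ⟨k, hk⟩ : ∃ k, L / 4 = k + 2 := ⟨L / 4 - 2, by omega⟩
  obtain ⟨k', hk'⟩ : ∃ k', L' / 4 = k' + 2 := ⟨L' / 4 - 2, by omega⟩
  have hδ0 : 0 ≤ boxDefect Z L := by
    have h := (defect_facts (hT L L L hL2 hL2 hL2) k).1
    simpa only [boxDefect, hk] using h
  have hδ'1 : boxDefect Z L' ≤ 1 := by
    have h := (defect_facts (hT L' L' L' hL'2 hL'2 hL'2) k').2.1
    simpa only [boxDefect, hk'] using h
  set δ : ℝ := boxDefect Z L with hδdef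
  by_cases hbig : (2 : ℝ) ^ 10 * δ ≥ 1
  · -- `δ ≥ 2⁻¹⁰`: `δ' ≤ 1 ≤ 2²⁰ δ²`
    have h1 : 1 ≤ ((2 : ℝ) ^ 10 * δ) ^ 2 := by nlinarith
    have h2 : ((2 : ℝ) ^ 10 * δ) ^ 2 = 2 ^ 20 * δ ^ 2 := by ring
    linarith
  · push Not at hbig
    -- `δ < 2⁻¹⁰`: `(e^{432δ})² = e^{864δ} ≤ e¹ < 2.7182818286`
    have h864 : 864 * δ ≤ 1 := by nlinarith
    have hE : Real.exp (432 * δ) ^ 2 ≤ Real.exp 1 := by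
      rw [← Real.exp_nat_mul]
      exact Real.exp_le_exp.2 (by push_cast; linarith)
    have hE' : Real.exp (432 * δ) ^ 2 < 2.7182818286 := hE.trans_lt Real.exp_one_lt_d9
    have e5 : 2 * (432 * δ * Real.exp (432 * δ)) ^ 2 = 2 * 432 ^ 2 * δ ^ 2 * Real.exp (432 * δ) ^ 2 := by ring
    have hδ2 : 0 ≤ 2 * 432 ^ 2 * δ ^ 2 := by positivity
    have e6 : 2 * 432 ^ 2 * δ ^ 2 * Real.exp (432 * δ) ^ 2 ≤ 2 * 432 ^ 2 * δ ^ 2 * 2.7182818286 :=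
      mul_le_mul_of_nonneg_left hE'.le hδ2
    nlinarith

end Family

section Model

variable {G : Type} [Group G] [TopologicalSpace G] [IsTopologicalGroup G] [CompactSpace G]
  [MeasurableSpace G] [BorelSpace G]

/-- **The cold defect of the Wilson model squares with constant `2²⁰`**: for every lattice representation `r` of a
compact `G`, every `β ≥ 0`, `L ≥ 8` and `L' ∈ [2L, 4L]`: `coldDefect r.ρ β L' ≤ 2²⁰ · (coldDefect r.ρ β L)²` — the
explicit-constant form of `coldDoublingRecursionSC_holds` (`C = 2²⁰`, `β₀ = 0`, `L₀ = 8`; basin threshold `1/(16C) = 2⁻²⁴`). -/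
theorem coldDefect_sq_le_two_pow (r : LatticeRep G) {β : ℝ} (hβ : 0 ≤ β) (L : ℕ) (hL : 8 ≤ L) (L' : ℕ)
    (h₁ : 2 * L ≤ L') (h₂ : L' ≤ 4 * L) :
    coldDefect r.ρ β L' ≤ 2 ^ 20 * coldDefect r.ρ β L ^ 2 := by
  rw [coldDefect_eq_boxDefect, coldDefect_eq_boxDefect]
  exact defectSquaring_two_pow (axisSymmetric r β) (tracePositive r hβ) (volumeBounds r hβ) L hL L' h₁ h₂

end Model

end Summit.QuantumFields.YangMills.Cruxes.IR.AspectBootstrap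

end
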